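import Summits.Parity.GeneralizedHardyLittlewood.Theorems.LeeYangFibresCellParityLawSieveDefs
import Summits.Parity.GeneralizedHardyLittlewood.Theorems.LeeYangFibresCellParityLawPrLawTwoAssembly
import Summits.Parity.GeneralizedHardyLittlewood.Theorems.LeeYangFibresCellParityLawSingularRatio
import Summits.Parity.GeneralizedHardyLittlewood.Theorems.LeeYangFibresCellParityLawEulerRatio
import Literature.NumberTheory.Sieve.SieveFunctions
import Literature.NumberTheory.Sieve.SieveFramework
import Literature.NumberTheory.Sieve.RosserSieveTheoremOneHalfLt
import Literature.NumberTheory.Sieve.SieveFunctionsBridge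
import Literature.NumberTheory.Sieve.LinearSieveConstant
import Literature.NumberTheory.Sieve.LinearFormsRoughTupleBound
import Literature.NumberTheory.Sieve.LinearEquationsInPrimesSubsystems
import HarnessLib

/-!
# Route `LeeYangFibres`, crux `CellParityLaw` (stmt-Parity-14109), line `section-annihilator`:
# the registered stub `stub_prLawTwoMainCell` — the prime cell at `u = 2`, with the sharp constant `2`

We prove `PrLawTwoMainCell` (vocabulary file `LeeYangFibresCellParityLawSieveDefs`): in the non-degenerate
case, for `N ≥ N₀(t, L, B)`, the prime cell of the `i`-th coordinate section of a `(t+1)`-form system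
satisfies `C_{(1,j')} ≤ 2 a_1 H_{Ψ,i} F⁽ⁱ⁾_{j'} + N/(log^{t+1} N (log log N)^B)` — the factor-`2` upper
bound of the LINEAR SIEVE with the EXACT main term of Bombieri's `P_r` law, given the atom's level of
distribution. With `η = (log log N)^{-B_η}`, `B_η = B + t + D + 2`, `y = N^{1-η}`, `z = y^{1/2}`:
* `C_{(1,j')} ≤ S(b, z)` (`SectionSeqFacts` (c)) and Iwaniec's Theorem 1 (`Iwaniec1980_thm1_upper_of_half_lt`,
  uniform over `Ω(1, L')` sequences, `SectionDimension`) at `s = log y/log z = 2`, `F(2) = e^γ`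
  (`upperSieveFun_one_eq_holds`): `S(b,z) ≤ F V(z)(e^γ + C_I (log y)^{-1/3}) + ∑_{d<y, d∣P(z)} |R_d|`,
  where the remainders ARE the atom's discrepancies (`SectionSeqFacts` (b)), so the sum is
  `≤ N/log^{t+3} N` (`SectionLevelAt t` at `A = t + 3`, `B = B_η`);
* `e^γ V(z) ≤ (2/((1-η) log N)) H (1 + C/log N)` (`SectionMertens`, sharp clause), `H = 𝔖(Ψ)/𝔖(Ψ₋ᵢ)`
  (`EulerRatioIdentity`) with `0 ≤ H ≤ C_s (log log N)^D` (`stub_singularRatio`),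
  `F ≤ C_R (log log N)^t N/log^t N` (`uniformRoughTupleBound` via `PrLawTwoPrep` (c)),
  `a_1 ≥ 1/log N - C_a/log² N` (`PrLawTwoPrep` (b), Alladi);
* eventually `C/log N, C_a/log N, (|C_I|+1)(log y)^{-1/3} ≤ η ≤ 1/2`: the sieve bound is `≤ (2HF/log N)(1+7η)`,
  `2 a_1 H F ≥ (2HF/log N)(1-η)`, and the excess `16ηHF/log N ≤ 16 C_s C_R N/(log^{t+1}N (log log N)^{B+2}) ≤ E/2`.

References: H. Iwaniec, Acta Arith. 36 (1980) Thm 1 [IwaniecActaArith1980]; E. Bombieri, RIMS Kôkyûroku 294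
(1977) p. 5 [BombieriRIMS1977]; K. Alladi, Quart. J. Math. 33 (1982) Thm 1 [Alladi1982].
-/

noncomputable section

open scoped BigOperators Topology Classical
open Finset Filter Literature.NumberTheory.Sieve

namespace Summit.Parity.GeneralizedHardyLittlewood.Cruxes.CellParityLaw.SectionAnnihilator



namespace MainCellAux

/-- `g(1) = 1` for the section density (empty product). -/
theorem sectionDensity_one {t : ℕ} (Ψ : Fin (t + 1) → AffLinForm 1) (i : Fin (t + 1)) :
    sectionDensity Ψ i 1 = 1 := by
  unfold sectionDensity
  rw [Nat.primeFactors_one, Finset.prod_empty]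

/-- The density product of a section sequence over `P(z)` is `∏_{p < z} (1 - g(p))`. -/
theorem densityProduct_sectionSeq {t : ℕ} (Ψ : Fin (t + 1) → AffLinForm 1) (K : Set (Fin 1 → ℝ))
    (N u : ℕ) (i : Fin (t + 1)) (j' : Fin t → ℕ) (e : ℕ) (z : ℝ) :
    (sectionSeq Ψ K N u i j' e).densityProduct (primesProdBelow z) =
      ∏ p ∈ Nat.primesBelow ⌈z⌉₊, (1 - sectionDensity Ψ i p) := by
  unfold SieveSequence.densityProduct
  rw [primeFactors_primesProdBelow]
  refine Finset.prod_congr rfl fun p hp => ?_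
  have hp' : p.Prime := Nat.prime_of_mem_primesBelow hp
  change 1 - sectionDensityFn Ψ i p = _
  rw [sectionDensityFn_apply Ψ i hp'.ne_zero]

end MainCellAux

open MainCellAux PrLawTwoAssemblyAux in
/-- **`stub_prLawTwoMainCell`** (registered stub of the line `section-annihilator`, skeleton v9): the sharp
prime-cell bound `C_{(1,j')} ≤ 2 a_1 H F + N/(log^{t+1} N (log log N)^B)` at `u = 2` in the non-degenerate
case — Iwaniec's linear sieve at `s = 2` (`F(2) = e^γ`) on the section sequence with `y = N^{1-η}`,
`z = y^{1/2}`, `η = (log log N)^{-(B+t+D+2)}` and the atom's remainders; the sharp Mertens-side bound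
`e^γ V(z) ≤ (2/((1-η) log N)) H (1 + C/log N)`; `a_1 ≥ 1/log N - C/log² N`;
`F ≤ C (log log N)^t N/log^t N`; `H ≤ C (log log N)^D`. -/
theorem stub_prLawTwoMainCell : PrLawTwoMainCell := by
  intro hF hD hM hE hP t ht hA L B
  -- constants
  obtain ⟨L', hL'⟩ := hD t
  obtain ⟨Bd, hBd, hBC⟩ := Iwaniec1980_thm1_upper_of_half_lt (κ := 1) (by norm_num)
  obtain ⟨CI, hCI⟩ := hBC L'
  set G : ℝ := Real.exp Real.eulerMascheroniConstant with hG
  have hG1 : 1 ≤ G := by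
    rw [hG]; exact Real.one_le_exp (by linarith [Real.one_half_lt_eulerMascheroniConstant])
  have hF2 : Bd.1 2 = G := by
    rw [hBd.eqOn_iwaniecSieveFun.1 (show (2 : ℝ) ∈ Set.Ioi 0 by norm_num), ← upperSieveFun_one,
      upperSieveFun_one_eq_holds ⟨by norm_num, by norm_num⟩, hG]
    ring
  obtain ⟨Cs, hCs0, D, Ns, hSR⟩ := stub_singularRatio t L
  obtain ⟨CR, NR, hR⟩ := uniformRoughTupleBound t L 2 (by norm_num)
  set Bη : ℕ := B + t + D + 2 with hBη
  obtain ⟨C3, N3, h3⟩ := hM t L Bη (by omega)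
  obtain ⟨NA, hAt⟩ := hA L 2 (t + 3) Bη le_rfl
  obtain ⟨NE, hEu⟩ := hE t L 2 le_rfl
  obtain ⟨-, ⟨Ca, hCa0, ha1⟩, hIncl, hVal, -⟩ := hP
  set cI : ℝ := |CI| + 1 with hcI
  have hcI0 : 0 < cI := by rw [hcI]; positivity
  set cR : ℝ := |CR| with hcR
  -- eventual analytic conditions
  have hpow_le := @eventually_const_mul_loglog_pow_le
  have hev : ∀ᶠ N : ℕ in atTop, 2 ≤ Real.log (Real.log (N : ℝ)) ∧
      |C3| * Real.log (Real.log (N : ℝ)) ^ Bη ≤ Real.log N ∧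
      Ca * Real.log (Real.log (N : ℝ)) ^ Bη ≤ Real.log N ∧
      2 * cI ^ 3 * Real.log (Real.log (N : ℝ)) ^ (3 * Bη) ≤ Real.log N ∧
      2 * (16 * Cs * cR) ≤ Real.log (Real.log (N : ℝ)) ^ 2 ∧
      2 * Real.log (Real.log (N : ℝ)) ^ B ≤ Real.log N ^ 2 := by
    have e5 : ∀ᶠ N : ℕ in atTop, 2 * (16 * Cs * cR) ≤ Real.log (Real.log (N : ℝ)) ^ 2 := by
      filter_upwards [eventually_le_loglog (max 1 (2 * (16 * Cs * cR)))] with N hN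
      have h1 : 1 ≤ Real.log (Real.log (N : ℝ)) := le_trans (le_max_left _ _) hN
      calc 2 * (16 * Cs * cR) ≤ Real.log (Real.log (N : ℝ)) := le_trans (le_max_right _ _) hN
        _ ≤ Real.log (Real.log (N : ℝ)) ^ 2 := by nlinarith
    have e6 : ∀ᶠ N : ℕ in atTop, 2 * Real.log (Real.log (N : ℝ)) ^ B ≤ Real.log N ^ 2 := by
      filter_upwards [hpow_le B 2 (by norm_num),
        (Real.tendsto_log_atTop.comp tendsto_natCast_atTop_atTop).eventually_ge_atTop (1 : ℝ)] with N hN hl1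
      have hl1' : (1 : ℝ) ≤ Real.log (N : ℝ) := hl1
      calc 2 * Real.log (Real.log (N : ℝ)) ^ B ≤ Real.log N := hN
        _ = Real.log N * 1 := (mul_one _).symm
        _ ≤ Real.log N * Real.log N := by gcongr
        _ = Real.log N ^ 2 := (sq _).symm
    filter_upwards [eventually_le_loglog 2, hpow_le Bη |C3| (abs_nonneg _), hpow_le Bη Ca hCa0,
      hpow_le (3 * Bη) (2 * cI ^ 3) (by positivity), e5, e6] with N h1 h2 h3 h4 h5 h6
    exact ⟨h1, h2, h3, h4, h5, h6⟩
  -- all thresholds at once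
  obtain ⟨N₀, hN₀⟩ := Filter.eventually_atTop.1 (hev.and ((eventually_ge_atTop Ns).and
    ((eventually_ge_atTop NR).and ((eventually_ge_atTop N3).and ((eventually_ge_atTop NA).and
      ((eventually_ge_atTop NE).and (eventually_ge_atTop 16)))))))
  refine ⟨N₀, fun N hN Ψ hΨ hL K hK hKN i j' hj' hlt1 hS => ?_⟩
  obtain ⟨⟨hll2, hC3l, hCal, hcIl, hKll, hBl⟩, hNs, hNR, hN3, hNA, hNE, hN16⟩ := hN₀ N hN
  have hNpos : 0 < N := by omega
  set Nr : ℝ := (N : ℝ) with hNr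
  have hNr16 : (16 : ℝ) ≤ Nr := by rw [hNr]; exact_mod_cast hN16
  have hNr1 : (1 : ℝ) < Nr := by linarith
  have hNr0 : (0 : ℝ) < Nr := by linarith
  set ℓ : ℝ := Real.log Nr with hℓ
  set ℓℓ : ℝ := Real.log ℓ with hℓℓ
  have hℓℓ2 : 2 ≤ ℓℓ := hll2
  have hℓ7 : 7 ≤ ℓ := by
    -- `ℓℓ ≥ 2` gives `ℓ ≥ e² > 7`
    by_contra hlt
    push Not at hlt
    have hℓpos : 0 < ℓ := Real.log_pos hNr1
    have : ℓℓ < 2 := by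
      rw [hℓℓ, Real.log_lt_iff_lt_exp hℓpos]
      have he : (7 : ℝ) < Real.exp 2 := by
        have := Real.add_one_lt_exp (show (2 : ℝ) ≠ 0 by norm_num)
        have h2 : Real.exp 2 = Real.exp 1 * Real.exp 1 := by rw [← Real.exp_add]; norm_num
        nlinarith [Real.exp_one_gt_d9]
      linarith
    linarith
  have hℓ0 : 0 < ℓ := by linarith
  have hℓℓ0 : 0 < ℓℓ := by linarith
  set η : ℝ := 1 / ℓℓ ^ Bη with hη
  have hBη1 : 1 ≤ Bη := by omega
  have hη0 : 0 < η := by rw [hη]; positivity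
  have hηhalf : η ≤ 1 / 2 := by
    rw [hη]
    refine one_div_le_one_div_of_le (by norm_num) ?_
    calc (2 : ℝ) ≤ ℓℓ := hℓℓ2
      _ = ℓℓ ^ 1 := (pow_one _).symm
      _ ≤ ℓℓ ^ Bη := pow_le_pow_right₀ (by linarith) hBη1
  have h1η : 1 / 2 ≤ 1 - η := by linarith
  have h1η0 : 0 < 1 - η := by linarith
  set y : ℝ := Nr ^ (1 - η) with hy
  set z : ℝ := Nr ^ ((1 - η) / 2) with hz
  have hlogy : Real.log y = (1 - η) * ℓ := by rw [hy, Real.log_rpow hNr0]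
  have hlogz : Real.log z = (1 - η) / 2 * ℓ := by rw [hz, Real.log_rpow hNr0]
  have hlogy0 : 0 < Real.log y := by rw [hlogy]; positivity
  have hratio : Real.log y / Real.log z = 2 := by rw [hlogy, hlogz]; field_simp
  have hz2 : 2 ≤ z := by
    have h14 : (1 : ℝ) / 4 ≤ (1 - η) / 2 := by linarith
    calc (2 : ℝ) = (16 : ℝ) ^ ((1 : ℝ) / 4) := by
          rw [show (16 : ℝ) = 2 ^ (4 : ℕ) by norm_num, ← Real.rpow_natCast,
            ← Real.rpow_mul (by norm_num)]; norm_num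
      _ ≤ Nr ^ ((1 : ℝ) / 4) := Real.rpow_le_rpow (by norm_num) hNr16 (by norm_num)
      _ ≤ Nr ^ ((1 - η) / 2) := Real.rpow_le_rpow_of_exponent_le hNr1.le h14
  have hzy : z ≤ y := Real.rpow_le_rpow_of_exponent_le hNr1.le (by linarith)
  have hzhalf : z ≤ Nr ^ ((1 : ℝ) / 2) := Real.rpow_le_rpow_of_exponent_le hNr1.le (by linarith)
  -- values on the box
  set x : ℝ := 2 * L * N with hx
  have hvals : ∀ n ∈ latticeBox 1 N, (((Ψ i).eval n : ℤ) : ℝ) ≤ x := fun n hn =>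
    hVal (t + 1) Ψ N L hNpos hL i n hn
  have hvals1 : ∀ n ∈ latticeBox 1 N, (((Ψ i).eval n : ℤ) : ℝ) ≤ (1 : ℕ) * x := fun n hn => by
    rw [Nat.cast_one, one_mul]; exact hvals n hn
  -- the section sequence and Iwaniec's theorem
  set A : SieveSequence := sectionSeq Ψ K N 2 i j' 1 with hAdef
  set B₁ : ℝ := (sectionMass Ψ K N 2 i j' 1 : ℝ) with hB₁
  have hB₁0 : 0 ≤ B₁ := Nat.cast_nonneg _
  have hsize : A.size x = B₁ := by
    change sectionDensity Ψ i 1 * (sectionMass Ψ K N 2 i j' 1 : ℝ) = B₁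
    rw [sectionDensity_one, one_mul]
  have hdimA : HasIwaniecDimension A.density 1 L' := hL' Ψ i hlt1
  have hI := hCI A hdimA x y z hz2 hzy (by rw [hsize]; exact hB₁0)
  rw [hsize, densityProduct_sectionSeq, hratio, hF2] at hI
  set V : ℝ := ∏ p ∈ Nat.primesBelow ⌈z⌉₊, (1 - sectionDensity Ψ i p) with hV
  -- the cell is sifted mass
  obtain ⟨-, hRem, hCell, -⟩ := hF t Ψ K N 2 i j'
  have hc : (cell Ψ K N 2 (i.insertNth 1 j') : ℝ) ≤ A.sifted x (primesProdBelow z) := by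
    refine hCell x z (by norm_num) hvals hz2 ?_
    simpa only [Nat.cast_ofNat] using hzhalf
  -- the remainders are the atom's discrepancies
  have hAtN := hAt N hNA Ψ hΨ hL K hK hKN i j' hj'
  -- (the sum is taken VERBATIM from Iwaniec's conclusion `hI`, to share its decidability instance)
  obtain ⟨Rs, hRsum, hI'⟩ : ∃ Rs : ℝ, Rs ≤ Nr / ℓ ^ (t + 3) ∧
      A.sifted x (primesProdBelow z) ≤ B₁ * V * (G + CI * Real.log y ^ (-(1 / 3 : ℝ))) + Rs := by
    refine ⟨_, ?_, hI⟩
    have hterm : ∀ d ∈ (Finset.range ⌈y⌉₊).filter (· ∣ primesProdBelow z),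
        |A.remainder d x| = |(sectionMass Ψ K N 2 i j' d : ℝ) -
          sectionDensity Ψ i d * (sectionMass Ψ K N 2 i j' 1 : ℝ)| := by
      intro d hd
      have hd0 : d ≠ 0 := fun h => by
        have := (Finset.mem_filter.mp hd).2
        rw [h, zero_dvd_iff] at this
        exact primesProdBelow_ne_zero z this
      rw [hRem 1 x le_rfl hvals1 d hd0 (Nat.coprime_one_left d), one_mul]
    rw [Finset.sum_congr rfl hterm]
    refine le_trans (Finset.sum_le_sum_of_subset_of_nonneg (fun d hd => ?_) fun _ _ _ => abs_nonneg _) hAtN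
    obtain ⟨hdr, hdP⟩ := Finset.mem_filter.mp hd
    have hd0 : d ≠ 0 := fun h => by
      rw [h, zero_dvd_iff] at hdP; exact primesProdBelow_ne_zero z hdP
    refine Finset.mem_filter.mpr ⟨Finset.mem_Icc.mpr ⟨Nat.one_le_iff_ne_zero.mpr hd0, ?_⟩,
      (squarefree_primesProdBelow z).squarefree_of_dvd hdP⟩
    have h1 : d < ⌈y⌉₊ := Finset.mem_range.mp hdr
    have h2 : ⌈y⌉₊ ≤ ⌊y⌋₊ + 1 := Nat.ceil_le_floor_add_one y
    change d ≤ ⌊y⌋₊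
    omega
  -- Mertens side, sharp
  have h3N := (h3 N hN3 Ψ hΨ hL i hlt1 hS).1
  change G * V ≤ 2 / ((1 - η) * ℓ) * sectionH Ψ i * (1 + C3 / ℓ) at h3N
  -- `H = 𝔖/𝔖'`, `0 ≤ H ≤ Cs ℓℓ^D`
  set Hh : ℝ := sectionH Ψ i with hHh
  obtain ⟨hS'0, hS0, hSle⟩ := hSR N hNs Ψ hΨ hL i
  have hS'pos : 0 < singularProduct (Fin.removeNth i Ψ) := lt_of_le_of_ne hS'0 (Ne.symm hS)
  have hHeq : Hh = singularProduct Ψ / singularProduct (Fin.removeNth i Ψ) :=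
    (hEu N hNE Ψ hΨ hL i).1 hS
  have hH0 : 0 ≤ Hh := by rw [hHeq]; exact div_nonneg hS0 hS'0
  have hHle : Hh ≤ Cs * ℓℓ ^ D := by
    rw [hHeq, div_le_iff₀ hS'pos]; exact hSle
  -- the fibre mass
  have hB₁le : B₁ ≤ cR * ℓℓ ^ t * Nr / ℓ ^ t := by
    have h1 := (hIncl t Ψ K N 2 i j' (by simpa only [Nat.cast_ofNat] using hz2.trans hzhalf)).2
    have h2 := hR N hNR (Fin.removeNth i Ψ) (SingularRatio.isNondegenerateSystem_removeNth hΨ i)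
      ((affLinSize_removeNth_le Ψ i (N : ℝ)).trans hL)
    have h3 : B₁ ≤ CR * Real.log (Real.log N) ^ t * N / Real.log N ^ t := by
      rw [hB₁]; exact le_trans (Nat.cast_le.mpr h1) h2
    refine h3.trans ?_
    have hX : 0 ≤ ℓℓ ^ t * Nr / ℓ ^ t := by positivity
    calc CR * Real.log (Real.log N) ^ t * N / Real.log N ^ t = CR * (ℓℓ ^ t * Nr / ℓ ^ t) := by
          rw [hℓℓ, hℓ, hNr]; ring
      _ ≤ cR * (ℓℓ ^ t * Nr / ℓ ^ t) := mul_le_mul_of_nonneg_right (le_abs_self CR) hX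
      _ = cR * ℓℓ ^ t * Nr / ℓ ^ t := by ring
  -- the prime-cell density from below
  have ha := ha1 N (by omega)
  change 1 / ℓ - Ca / ℓ ^ 2 ≤ modelDensity N 2 1 at ha
  set a : ℝ := modelDensity N 2 1 with hadef
  -- Iwaniec's error factor `λ = (log y)^{-1/3}` is below `η/cI`
  set lam : ℝ := Real.log y ^ (-(1 / 3 : ℝ)) with hlam
  have hlam0 : 0 ≤ lam := Real.rpow_nonneg hlogy0.le _
  have hlamle : cI * lam ≤ η := by
    -- `(cI/η)^3 ≤ log y /1`: from `2 cI³ ℓℓ^{3Bη} ≤ ℓ` and `log y ≥ ℓ/2`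
    have hAη : 0 < cI / η := div_pos hcI0 hη0
    have hcube : (cI / η) ^ 3 ≤ Real.log y := by
      have e1 : (cI / η) ^ 3 = cI ^ 3 * ℓℓ ^ (3 * Bη) := by
        rw [hη, pow_mul']; field_simp
      rw [e1, hlogy]
      have : cI ^ 3 * ℓℓ ^ (3 * Bη) ≤ ℓ / 2 := by linarith [hcIl]
      calc cI ^ 3 * ℓℓ ^ (3 * Bη) ≤ ℓ / 2 := this
        _ = 1 / 2 * ℓ := by ring
        _ ≤ (1 - η) * ℓ := by gcongr
    have h := rpow_neg_third_le hAη hlogy0 hcube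
    rw [← hlam, inv_div] at h
    calc cI * lam ≤ cI * (η / cI) := mul_le_mul_of_nonneg_left h hcI0.le
      _ = η := by field_simp
  -- small ratios
  have hC3η : C3 / ℓ ≤ η := by
    have h1 : C3 / ℓ ≤ |C3| / ℓ := div_le_div_of_nonneg_right (le_abs_self C3) hℓ0.le
    refine h1.trans ?_
    rw [hη, div_le_div_iff₀ hℓ0 (by positivity), one_mul]; exact hC3l
  have hCaη : Ca / ℓ ≤ η := by
    rw [hη, div_le_div_iff₀ hℓ0 (by positivity), one_mul]; exact hCal
  -- non-negativity of `V`
  have hV0 : 0 ≤ V := Finset.prod_nonneg fun p hp =>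
    sub_nonneg.mpr (le_of_lt (hlt1 p (Nat.prime_of_mem_primesBelow hp)))
  -- STEP 1: the sieve bound with Iwaniec's error absorbed: `B₁ V (G + CI λ) ≤ B₁ (G V) (1 + η)`
  have hstep1 : B₁ * V * (G + CI * lam) ≤ B₁ * (G * V) * (1 + η) := by
    have hCIle : |CI| ≤ cI := by rw [hcI]; linarith only []
    have h1 : CI * lam ≤ η := by
      calc CI * lam ≤ |CI| * lam := mul_le_mul_of_nonneg_right (le_abs_self CI) hlam0
        _ ≤ cI * lam := mul_le_mul_of_nonneg_right hCIle hlam0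
        _ ≤ η := hlamle
    have hGη : η ≤ G * η := le_mul_of_one_le_left hη0.le hG1
    have h2 : G + CI * lam ≤ G * (1 + η) := by linarith only [h1, hGη]
    calc B₁ * V * (G + CI * lam) ≤ B₁ * V * (G * (1 + η)) :=
          mul_le_mul_of_nonneg_left h2 (mul_nonneg hB₁0 hV0)
      _ = B₁ * (G * V) * (1 + η) := by ring
  -- STEP 2: the Mertens side: `G V ≤ (2/ℓ) Hh (1 + η)(1 + 2η)`
  have h2ℓ : 0 ≤ 2 / ℓ := div_nonneg zero_le_two hℓ0.le
  have h2ℓH : 0 ≤ 2 / ℓ * Hh := mul_nonneg h2ℓ hH0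
  have h2ℓHB : 0 ≤ 2 / ℓ * Hh * B₁ := mul_nonneg h2ℓH hB₁0
  have hHB0 : 0 ≤ 2 * Hh * B₁ := mul_nonneg (mul_nonneg zero_le_two hH0) hB₁0
  have hstep2 : G * V ≤ 2 / ℓ * Hh * ((1 + η) * (1 + 2 * η)) := by
    have hinv : 1 / (1 - η) ≤ 1 + 2 * η := by
      rw [div_le_iff₀ h1η0]
      nlinarith only [mul_nonneg hη0.le (sub_nonneg.mpr hηhalf)]
    have hinv0 : 0 ≤ 1 / (1 - η) := div_nonneg zero_le_one h1η0.le
    have hC3' : 1 + C3 / ℓ ≤ 1 + η := by linarith only [hC3η]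
    have hη1 : 0 ≤ 1 + η := by linarith only [hη0]
    calc G * V ≤ 2 / ((1 - η) * ℓ) * Hh * (1 + C3 / ℓ) := h3N
      _ = 2 / ℓ * Hh * (1 + C3 / ℓ) * (1 / (1 - η)) := by field_simp
      _ ≤ 2 / ℓ * Hh * (1 + η) * (1 + 2 * η) :=
          mul_le_mul (mul_le_mul_of_nonneg_left hC3' h2ℓH) hinv hinv0 (mul_nonneg h2ℓH hη1)
      _ = 2 / ℓ * Hh * ((1 + η) * (1 + 2 * η)) := by ring
  have hpoly : (1 + η) * (1 + 2 * η) * (1 + η) ≤ 1 + 7 * η := by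
    have key : (1 + η) * (1 + 2 * η) * (1 + η) = 1 + 4 * η + 5 * η ^ 2 + 2 * η ^ 3 := by ring
    have hA : η ^ 2 ≤ η * (1 / 2) := by
      rw [pow_two]; exact mul_le_mul_of_nonneg_left hηhalf hη0.le
    have hB : η ^ 3 ≤ η * (1 / 2) * (1 / 2) := by
      rw [pow_succ, pow_two]
      exact mul_le_mul (mul_le_mul_of_nonneg_left hηhalf hη0.le) hηhalf hη0.le (by positivity)
    rw [key]; linarith only [hA, hB]
  -- STEP 3: combine: sieve main part ≤ `2 Hh B₁/ℓ + 14 η Hh B₁/ℓ`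
  have hstep3 : B₁ * V * (G + CI * lam) ≤ 2 * (Hh * B₁ / ℓ) + 14 * (η * Hh * B₁ / ℓ) := by
    have h1 : B₁ * (G * V) * (1 + η) ≤ B₁ * (2 / ℓ * Hh * ((1 + η) * (1 + 2 * η))) * (1 + η) :=
      mul_le_mul_of_nonneg_right (mul_le_mul_of_nonneg_left hstep2 hB₁0) (by linarith only [hη0])
    have h2 : B₁ * (2 / ℓ * Hh * ((1 + η) * (1 + 2 * η))) * (1 + η) =
        2 / ℓ * Hh * B₁ * ((1 + η) * (1 + 2 * η) * (1 + η)) := by ring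
    have h3 : 2 / ℓ * Hh * B₁ * ((1 + η) * (1 + 2 * η) * (1 + η)) ≤ 2 / ℓ * Hh * B₁ * (1 + 7 * η) :=
      mul_le_mul_of_nonneg_left hpoly h2ℓHB
    have h4 : 2 / ℓ * Hh * B₁ * (1 + 7 * η) = 2 * (Hh * B₁ / ℓ) + 14 * (η * Hh * B₁ / ℓ) := by
      field_simp; ring
    linarith only [hstep1, h1, h2, h3, h4]
  -- STEP 4: the model term from below: `2 a Hh B₁ ≥ 2 Hh B₁/ℓ - 2 η Hh B₁/ℓ`
  have hstep4 : 2 * (Hh * B₁ / ℓ) - 2 * (η * Hh * B₁ / ℓ) ≤ 2 * a * Hh * B₁ := by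
    have h1 : 1 / ℓ - η / ℓ ≤ a := by
      have : Ca / ℓ ^ 2 ≤ η / ℓ := by
        rw [pow_two, ← div_div]; exact div_le_div_of_nonneg_right hCaη hℓ0.le
      linarith only [this, ha]
    have h2 : (1 / ℓ - η / ℓ) * (2 * Hh * B₁) ≤ a * (2 * Hh * B₁) :=
      mul_le_mul_of_nonneg_right h1 hHB0
    have h3 : (1 / ℓ - η / ℓ) * (2 * Hh * B₁) = 2 * (Hh * B₁ / ℓ) - 2 * (η * Hh * B₁ / ℓ) := by
      field_simp
    linarith only [h2, h3]
  -- STEP 5: the excess terms against the budget `E`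
  set E : ℝ := Nr / (ℓ ^ (t + 1) * ℓℓ ^ B) with hE
  have hpowsplit : ℓℓ ^ Bη = ℓℓ ^ (D + t) * ℓℓ ^ (B + 2) := by
    rw [← pow_add, hBη]; congr 1; omega
  have hexc1 : 16 * (η * Hh * B₁ / ℓ) ≤ E / 2 := by
    rw [show 16 * (η * Hh * B₁ / ℓ) = 16 * η * Hh * B₁ / ℓ by ring]
    -- `η Hh B₁ ≤ η (Cs ℓℓ^D)(cR ℓℓ^t Nr/ℓ^t)`
    have hCsD : 0 ≤ Cs * ℓℓ ^ D := mul_nonneg hCs0.le (pow_nonneg hℓℓ0.le D)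
    have h1 : Hh * B₁ ≤ (Cs * ℓℓ ^ D) * (cR * ℓℓ ^ t * Nr / ℓ ^ t) :=
      mul_le_mul hHle hB₁le hB₁0 hCsD
    have h2 : 16 * η * Hh * B₁ / ℓ ≤ 16 * η * ((Cs * ℓℓ ^ D) * (cR * ℓℓ ^ t * Nr / ℓ ^ t)) / ℓ := by
      apply div_le_div_of_nonneg_right _ hℓ0.le
      have : 16 * η * Hh * B₁ = 16 * η * (Hh * B₁) := by ring
      rw [this]
      exact mul_le_mul_of_nonneg_left h1 (mul_nonneg (by norm_num) hη0.le)
    refine h2.trans ?_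
    -- rewrite `η ℓℓ^{D+t} = 1/ℓℓ^{B+2}` and compare with `E/2` via `32 Cs cR ≤ ℓℓ²`
    have hℓℓB2 : 0 < ℓℓ ^ (B + 2) := by positivity
    have e : 16 * η * ((Cs * ℓℓ ^ D) * (cR * ℓℓ ^ t * Nr / ℓ ^ t)) / ℓ =
        16 * Cs * cR * (Nr / (ℓ ^ (t + 1) * ℓℓ ^ (B + 2))) := by
      rw [hη, show ℓℓ ^ Bη = ℓℓ ^ (D + t) * ℓℓ ^ (B + 2) from hpowsplit, pow_add ℓℓ D t]
      field_simp
      ring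
    rw [e, hE]
    rw [show Nr / (ℓ ^ (t + 1) * ℓℓ ^ B) / 2 = (ℓℓ ^ 2 / 2) * (Nr / (ℓ ^ (t + 1) * ℓℓ ^ (B + 2))) by
      field_simp; ring]
    exact mul_le_mul_of_nonneg_right (by linarith only [hKll]) (by positivity)
  have hexc2 : Nr / ℓ ^ (t + 3) ≤ E / 2 := by
    have hℓt : 0 ≤ ℓ ^ (t + 1) := pow_nonneg hℓ0.le _
    have hden : 2 * ℓ ^ (t + 1) * ℓℓ ^ B ≤ ℓ ^ (t + 3) := by
      calc 2 * ℓ ^ (t + 1) * ℓℓ ^ B = ℓ ^ (t + 1) * (2 * ℓℓ ^ B) := by ring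
        _ ≤ ℓ ^ (t + 1) * ℓ ^ 2 := mul_le_mul_of_nonneg_left hBl hℓt
        _ = ℓ ^ (t + 3) := by ring
    have hpos : 0 < 2 * ℓ ^ (t + 1) * ℓℓ ^ B :=
      mul_pos (mul_pos two_pos (pow_pos hℓ0 _)) (pow_pos hℓℓ0 _)
    calc Nr / ℓ ^ (t + 3) ≤ Nr / (2 * ℓ ^ (t + 1) * ℓℓ ^ B) :=
          div_le_div_of_nonneg_left hNr0.le hpos hden
      _ = E / 2 := by rw [hE, div_div]; congr 1; ring
  -- CONCLUSION (the abbreviations are generalised to opaque atoms, so that `linarith` stays syntactic)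
  have hsum : A.sifted x (primesProdBelow z) ≤ B₁ * V * (G + CI * lam) + Nr / ℓ ^ (t + 3) :=
    hI'.trans (add_le_add le_rfl hRsum)
  have hc' : (cell Ψ K N 2 (i.insertNth 1 j') : ℝ) ≤ B₁ * V * (G + CI * lam) + Nr / ℓ ^ (t + 3) :=
    hc.trans hsum
  generalize B₁ * V * (G + CI * lam) = MT at hc' hstep3
  generalize Hh * B₁ / ℓ = P at hstep3 hstep4
  generalize η * Hh * B₁ / ℓ = Q at hstep3 hstep4 hexc1
  generalize Nr / ℓ ^ (t + 3) = Rr at hc' hexc2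
  generalize 2 * a * Hh * B₁ = X₂ at hstep4 ⊢
  generalize E = E' at hexc1 hexc2 ⊢
  generalize (cell Ψ K N 2 (i.insertNth 1 j') : ℝ) = C₁ at hc' ⊢
  linarith only [hc', hstep3, hstep4, hexc1, hexc2]

end Summit.Parity.GeneralizedHardyLittlewood.Cruxes.CellParityLaw.SectionAnnihilator

end
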